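import Mathlib

/-!
# Route `FilamentSkeletonRss` · ∀-crux `TransverseReduction1AR` (stmt-NavierStokesRegularity-23611) / support 23920 — the ACCRETION-BUDGET SUM RULE
# (the algebra behind R8-3 / T2's «w*» and the barrier card «beyond-all-orders accretion balance of strained tubes in the Leray outflow»)

Helper file (theorems only), `--supports stmt-NavierStokesRegularity-23611 --as helper`; LEAD of 23611 / registrar of 23920, lane ns-filament-21221-p1 g14.

Bookkeeping of a finite exchange network: tubes `j ∈ Fin N`, directed transfer fluxes `T i j ≥ 0` (circulation leaving basin `i` and arriving in basin `j`),
escape fluxes `F j ≥ 0` (leaving basin `j` for the outflow region), axial weights `φ j > 0`.  With `leak j := Σ_i T j i + F j` and `feed j := Σ_i T i j`: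
* `budget_sum_identity` — `Σ_j φ_j (leak_j − feed_j) = Σ_j φ_j F_j + Σ_{i,j} T_{ij} (φ_i − φ_j)`;
* `budget_sum_eq_of_const_weights` — equal weights: the transfers cancel and the weighted budget is `φ · Σ_j F_j` (mass conservation: T2's control C0);
* `budget_sum_pos_of_small_asymmetry` — if the weight asymmetry is below the critical value, `max_{i,j}|φ_i − φ_j| · Σ_{i,j} T_{ij} < Σ_j φ_j F_j`, the weighted
  budget is POSITIVE (T2's «w* := F_∞/|ΔT|» lever threshold, N-tube form);
* `exists_budget_ne_zero_of_sum_ne_zero` — a non-zero weighted sum forbids a simultaneous zero of all per-tube budgets (no Poincaré–Miranda lever on `(B_j)`).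
MODELLING IDENTITY NOT ASSERTED HERE: `B_j^phys = −(leak − feed)_j / c₀` is R8 §2's reading of the accretion multipliers (idea-crit-7 F-6: NOT the gauge-dependent
cut-form coefficient `B p β j`).  HONEST FRAMING: finite-sum algebra for a MODEL argument on the negative side of a HYPOTHETICAL blow-up route; 23611/23920 OPEN;
nothing here bears on Navier–Stokes regularity, which is NOT proved.
-/

set_option linter.dupNamespace false

noncomputable section

namespace Summit.NavierStokesRegularity.NavierStokesRegularity.Theorems.DefectColumnGate

open scoped BigOperators
open Finset

/-- **The accretion-budget sum rule.**  `Σ_j φ_j ((Σ_i T_{ji} + F_j) − Σ_i T_{ij}) = Σ_j φ_j F_j + Σ_i Σ_j T_{ij} (φ_i − φ_j)`. -/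
theorem budget_sum_identity {N : ℕ} (φ F : Fin N → ℝ) (T : Fin N → Fin N → ℝ) :
    ∑ j, φ j * ((∑ i, T j i + F j) - ∑ i, T i j) = ∑ j, φ j * F j + ∑ i, ∑ j, T i j * (φ i - φ j) := by
  have h1 : ∑ j, φ j * ((∑ i, T j i + F j) - ∑ i, T i j) = ∑ j, φ j * F j + (∑ j, ∑ i, φ j * T j i - ∑ j, ∑ i, φ j * T i j) := by
    simp only [mul_sub, mul_add, sum_add_distrib, sum_sub_distrib, mul_sum]
    ring
  have h2 : ∑ i, ∑ j, T i j * (φ i - φ j) = ∑ i, ∑ j, φ i * T i j - ∑ i, ∑ j, φ j * T i j := by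
    simp only [mul_sub, sum_sub_distrib]
    congr 1 <;> (refine sum_congr rfl fun i _ => sum_congr rfl fun j _ => ?_) <;> ring
  rw [h1, h2, Finset.sum_comm (f := fun j i => φ j * T i j)]

/-- **Equal weights: the transfers cancel.**  `Σ_j φ (leak_j − feed_j) = φ · Σ_j F_j` — the mass-conservation identity (T2's control C0). -/
theorem budget_sum_eq_of_const_weights {N : ℕ} (c : ℝ) (F : Fin N → ℝ) (T : Fin N → Fin N → ℝ) :
    ∑ j, c * ((∑ i, T j i + F j) - ∑ i, T i j) = c * ∑ j, F j := by
  rw [budget_sum_identity (fun _ => c) F T]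
  simp [mul_sum]

/-- **Below the critical weight asymmetry the weighted budget is positive.**  If `T ≥ 0`, and the weight spread `w` satisfies `|φ_i − φ_j| ≤ w` for all
`i, j` and `w · Σ_{i,j} T_{ij} < Σ_j φ_j F_j`, then `Σ_j φ_j (leak_j − feed_j) > 0`. -/
theorem budget_sum_pos_of_small_asymmetry {N : ℕ} (φ F : Fin N → ℝ) (T : Fin N → Fin N → ℝ) (w : ℝ)
    (hT : ∀ i j, 0 ≤ T i j) (hw : ∀ i j, |φ i - φ j| ≤ w) (hcrit : w * ∑ i, ∑ j, T i j < ∑ j, φ j * F j) :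
    0 < ∑ j, φ j * ((∑ i, T j i + F j) - ∑ i, T i j) := by
  rw [budget_sum_identity]
  have hlow : -(w * ∑ i, ∑ j, T i j) ≤ ∑ i, ∑ j, T i j * (φ i - φ j) := by
    rw [mul_sum, ← sum_neg_distrib]
    refine sum_le_sum fun i _ => ?_
    rw [mul_sum, ← sum_neg_distrib]
    refine sum_le_sum fun j _ => ?_
    have h1 : -w ≤ φ i - φ j := by
      have := hw i j
      rw [abs_le] at this
      exact this.1
    nlinarith [hT i j]
  linarith

/-- **No simultaneous zero.**  If the weighted sum of the per-tube budgets is non-zero, some per-tube budget is non-zero — so the `N` multipliers `(B_j)`, read as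
`−(leak − feed)_j / c₀`, admit no common zero at such a parameter (no Poincaré–Miranda lever). -/
theorem exists_budget_ne_zero_of_sum_ne_zero {N : ℕ} (φ x : Fin N → ℝ) (h : ∑ j, φ j * x j ≠ 0) : ∃ j, x j ≠ 0 := by
  by_contra hall
  push Not at hall
  exact h (sum_eq_zero fun j _ => by rw [hall j, mul_zero])

/-! ## The two-tube NET form (appended by LEAD g14 after the T2 read: the table's `w* = F_∞/|T_ji − T_ij|` uses the NET transfer) -/

/-- **Two tubes, net transfer.**  `φ₁((T₁₂ + F₁) − T₂₁) + φ₂((T₂₁ + F₂) − T₁₂) = φ₁F₁ + φ₂F₂ + (φ₁ − φ₂)(T₁₂ − T₂₁)`. -/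
theorem budget_sum_two (φ₁ φ₂ F₁ F₂ T₁₂ T₂₁ : ℝ) :
    φ₁ * ((T₁₂ + F₁) - T₂₁) + φ₂ * ((T₂₁ + F₂) - T₁₂) = φ₁ * F₁ + φ₂ * F₂ + (φ₁ - φ₂) * (T₁₂ - T₂₁) := by
  ring

/-- **The `w*` threshold, net form.**  If the weight asymmetry times the NET transfer is below the weighted escape, `|φ₁ − φ₂|·|T₁₂ − T₂₁| < φ₁F₁ + φ₂F₂`, the two-tube
weighted budget is positive (T2's «w* := F_∞/|ΔT| > |δφ|/φ̄ ⇒ no sign change»). -/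
theorem budget_sum_two_pos (φ₁ φ₂ F₁ F₂ T₁₂ T₂₁ : ℝ) (h : |φ₁ - φ₂| * |T₁₂ - T₂₁| < φ₁ * F₁ + φ₂ * F₂) :
    0 < φ₁ * ((T₁₂ + F₁) - T₂₁) + φ₂ * ((T₂₁ + F₂) - T₁₂) := by
  rw [budget_sum_two]
  have h1 : -(|φ₁ - φ₂| * |T₁₂ - T₂₁|) ≤ (φ₁ - φ₂) * (T₁₂ - T₂₁) := by
    rw [← abs_mul]; exact neg_abs_le _
  linarith

/-- **Wrong orientation never closes the lever.**  If the heavier-weighted tube is the net DONOR (`(φ₁ − φ₂)(T₁₂ − T₂₁) ≥ 0`) and some escape flux is weighted positively,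
the two-tube weighted budget is positive whatever the size of the asymmetry (LEAD L-3 (i): the net RECEIVER must carry the larger weight for a sign change). -/
theorem budget_sum_two_pos_of_orientation (φ₁ φ₂ F₁ F₂ T₁₂ T₂₁ : ℝ) (hor : 0 ≤ (φ₁ - φ₂) * (T₁₂ - T₂₁)) (hF : 0 < φ₁ * F₁ + φ₂ * F₂) :
    0 < φ₁ * ((T₁₂ + F₁) - T₂₁) + φ₂ * ((T₂₁ + F₂) - T₁₂) := by
  rw [budget_sum_two]
  linarith

end Summit.NavierStokesRegularity.NavierStokesRegularity.Theorems.DefectColumnGate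

end
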